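import Mathlib.Algebra.MvPolynomial.PDeriv
import Mathlib.RingTheory.MvPolynomial.Basic
import Mathlib.Algebra.Algebra.Rat
import HarnessLib

/-!
# The formal integral over the unit cube, the formal fundamental theorem of calculus and the
chain rule for multivariate polynomials

Topic `Literature/RingTheory/MvPolynomial`.  Purely algebraic tools for *interpolation formulas*
(Battle–Federbush / Brydges–Kennedy tree expansions, `Literature/Probability/LatticeModels/
BattleFederbushExpansion.lean`), in which every interpolated quantity is a polynomial in the
interpolation parameters `t = (tᵢ)_{i ∈ ι}` ranging over the unit cube `[0,1]^ι`:

* `cubeWeight d = ∏ᵢ (dᵢ + 1)⁻¹ = ∫_{[0,1]^ι} t^d dt` and the **formal cube integral**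
  `cubeIntegral : MvPolynomial ι R →ₗ[R] R`, `∫ (Σ a_d t^d) = Σ a_d ∏ᵢ (dᵢ + 1)⁻¹` over a commutative
  `ℚ`-algebra `R` (`cubeIntegral_monomial`, `cubeIntegral_C`);
* `substAt v c = aeval (update X v (C c))`, the substitution `t_v ↦ c` (`substAt_monomial`,
  `substAt_monomial_of_eq_zero`);
* the **formal fundamental theorem of calculus in one variable under the cube integral**
  (`cubeIntegral_monomial_mul_pderiv`): for a monomial weight `w = a t^d` not involving `t_v`,
  `∫ w · ∂_v H = ∫ w · (H|_{t_v = 1} - H|_{t_v = 0})`;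
* the **chain rule** (`derivation_algHom_apply`): for an algebra map `φ` out of
  `MvPolynomial ι R` into a commutative `R`-algebra `A` and an `R`-derivation `D` of `A`,
  `D (φ F) = Σᵢ φ (∂ᵢ F) · D (φ tᵢ)`.

Everything is a definition with a body or a proved theorem; no named fact is introduced.
Mathlib has the formal partial derivative `MvPolynomial.pderiv` (a `Derivation`), `aeval`,
`MvPolynomial.basisMonomials`, but no formal integration functional and no chain rule in this
form (grep `integral`, `chain` in `Mathlib/Algebra/MvPolynomial`). [folklore]
-/

noncomputable section

open MvPolynomial Finsupp

namespace Literature.RingTheory.MvPolynomial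

variable {ι : Type*} {R : Type*} [CommRing R]

/-! ### Substitution of a constant for one variable -/

section Subst

variable [DecidableEq ι]

/-- The substitution `t_v ↦ c` (all other variables unchanged), an `R`-algebra endomorphism of
`MvPolynomial ι R`. [folklore] -/
def substAt (v : ι) (c : R) : MvPolynomial ι R →ₐ[R] MvPolynomial ι R :=
  aeval (Function.update X v (C c))

/-- `t_v ↦ c` sends `t_v` to `c`. [folklore] -/
theorem substAt_X_self (v : ι) (c : R) : substAt v c (X v : MvPolynomial ι R) = C c := by
  simp [substAt]

/-- `t_v ↦ c` fixes the other variables. [folklore] -/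
theorem substAt_X_of_ne {v i : ι} (h : i ≠ v) (c : R) :
    substAt v c (X i : MvPolynomial ι R) = X i := by
  simp [substAt, Function.update_of_ne h]

/-- `t_v ↦ c` fixes constants. [folklore] -/
theorem substAt_C (v : ι) (c a : R) : substAt v c (C a : MvPolynomial ι R) = C a := by
  simp [substAt]

variable [Fintype ι]

/-- `t^d |_{t_v = c} = c^{d_v} t^{d - d_v e_v}`. [folklore] -/
theorem substAt_monomial (v : ι) (c : R) (d : ι →₀ ℕ) (a : R) :
    substAt v c (monomial d a) = monomial (d.erase v) (a * c ^ d v) := by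
  rw [substAt, aeval_monomial, Finsupp.prod_fintype _ _ (fun i => by simp), monomial_eq,
    Finsupp.prod_fintype _ _ (fun i => by simp), algebraMap_eq, C_mul, mul_assoc]
  congr 1
  rw [← Finset.mul_prod_erase Finset.univ _ (Finset.mem_univ v),
    ← Finset.mul_prod_erase Finset.univ (fun i => X i ^ (d.erase v) i) (Finset.mem_univ v)]
  simp only [Function.update_self, Finsupp.erase_same, pow_zero, one_mul, ← map_pow, mul_comm (C (c ^ d v))]
  congr 1
  refine Finset.prod_congr rfl fun i hi => ?_
  have hiv : i ≠ v := Finset.ne_of_mem_erase hi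
  rw [Function.update_of_ne hiv, Finsupp.erase_ne hiv]

/-- A monomial not involving `t_v` is fixed by `t_v ↦ c`. [folklore] -/
theorem substAt_monomial_of_eq_zero (v : ι) (c : R) {d : ι →₀ ℕ} (hd : d v = 0) (a : R) :
    substAt v c (monomial d a) = monomial d a := by
  rw [substAt_monomial, hd, pow_zero, mul_one, Finsupp.erase_of_notMem_support]
  simpa [Finsupp.mem_support_iff] using hd

end Subst

/-! ### The formal cube integral -/

section Cube

variable [Fintype ι]

/-- `∫_{[0,1]^ι} t^d dt = ∏ᵢ (dᵢ + 1)⁻¹`, the weight of the monomial `t^d` under the formal cube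
integral. [folklore] -/
def cubeWeight (d : ι →₀ ℕ) : ℚ := ∏ i, ((d i : ℚ) + 1)⁻¹

/-- `∫_{[0,1]^ι} 1 dt = 1`. [folklore] -/
@[simp] theorem cubeWeight_zero : cubeWeight (0 : ι →₀ ℕ) = 1 := by
  simp [cubeWeight]

variable [Algebra ℚ R]

variable (ι R) in
/-- **The formal integral over the unit cube** `∫_{[0,1]^ι} · dt : MvPolynomial ι R →ₗ[R] R`,
`Σ_d a_d t^d ↦ Σ_d a_d ∏ᵢ (dᵢ + 1)⁻¹` (the `R`-linear map sending the monomial basis vector `t^d` to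
`∏ᵢ (dᵢ + 1)⁻¹`), over a commutative `ℚ`-algebra `R`.  For `R = ℝ, ℂ` it is the Lebesgue integral of
the polynomial function over `[0,1]^ι`; here it is used formally. [folklore] -/
def cubeIntegral : MvPolynomial ι R →ₗ[R] R :=
  (MvPolynomial.basisMonomials ι R).constr R fun d => algebraMap ℚ R (cubeWeight d)

/-- `∫ a t^d dt = a ∏ᵢ (dᵢ + 1)⁻¹`. [folklore] -/
theorem cubeIntegral_monomial (d : ι →₀ ℕ) (a : R) :
    cubeIntegral ι R (monomial d a) = a * algebraMap ℚ R (cubeWeight d) := by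
  have h : monomial d a = a • (MvPolynomial.basisMonomials ι R) d := by
    rw [MvPolynomial.coe_basisMonomials, smul_monomial, smul_eq_mul, mul_one]
  rw [h, map_smul, cubeIntegral, Module.Basis.constr_basis, smul_eq_mul]

/-- `∫ a dt = a`. [folklore] -/
@[simp] theorem cubeIntegral_C (a : R) : cubeIntegral ι R (C a) = a := by
  rw [← monomial_zero', cubeIntegral_monomial, cubeWeight_zero, map_one, mul_one]

/-- `∫ 1 dt = 1`. [folklore] -/
@[simp] theorem cubeIntegral_one : cubeIntegral ι R (1 : MvPolynomial ι R) = 1 := by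
  rw [← C_1, cubeIntegral_C]

variable [DecidableEq ι]

/-- The one-variable computation behind the formal fundamental theorem of calculus:
`(n + 1) ∫ t^{d + e} dt = ∫ t^{d + e'} dt` when `e_v = n`, `e'` is `e` with `e_v ↦ 0`… stated as
`e_v · w(d + (e - e_v)) = (1 - 0^{e_v}) · w(d + e|_{v ↦ 0})` for `d_v = 0`. [folklore] -/
theorem cubeWeight_ftc_aux {v : ι} {d : ι →₀ ℕ} (hd : d v = 0) (e : ι →₀ ℕ) :
    (e v : ℚ) * cubeWeight (d + (e - Finsupp.single v 1)) =
      (1 - (0 : ℚ) ^ e v) * cubeWeight (d + e.erase v) := by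
  rcases Nat.eq_zero_or_pos (e v) with h0 | hpos
  · simp [h0]
  · obtain ⟨n, hn⟩ : ∃ n, e v = n + 1 := ⟨e v - 1, by omega⟩
    rw [hn, pow_succ, mul_zero, sub_zero, one_mul, cubeWeight, cubeWeight,
      ← Finset.mul_prod_erase Finset.univ _ (Finset.mem_univ v),
      ← Finset.mul_prod_erase Finset.univ (fun i => ((((d + e.erase v : ι →₀ ℕ) i : ℕ) : ℚ) + 1)⁻¹)
        (Finset.mem_univ v)]
    have h1 : (((d + (e - Finsupp.single v 1) : ι →₀ ℕ) v : ℕ) : ℚ) + 1 = n + 1 := by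
      rw [Finsupp.add_apply, Finsupp.tsub_apply, Finsupp.single_eq_same, hd, hn, Nat.add_sub_cancel,
        zero_add]
    have h2 : (((d + e.erase v : ι →₀ ℕ) v : ℕ) : ℚ) + 1 = 1 := by
      rw [Finsupp.add_apply, Finsupp.erase_same, hd, add_zero, Nat.cast_zero, zero_add]
    have h3 : ∀ i ∈ Finset.univ.erase v,
        ((((d + (e - Finsupp.single v 1) : ι →₀ ℕ) i : ℕ) : ℚ) + 1)⁻¹ =
          ((((d + e.erase v : ι →₀ ℕ) i : ℕ) : ℚ) + 1)⁻¹ := by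
      intro i hi
      have hiv : i ≠ v := Finset.ne_of_mem_erase hi
      rw [Finsupp.add_apply, Finsupp.add_apply, Finsupp.tsub_apply, Finsupp.single_eq_of_ne hiv,
        Finsupp.erase_ne hiv, Nat.sub_zero]
    rw [h1, h2, Finset.prod_congr rfl h3, inv_one, one_mul, ← mul_assoc]
    have hn1 : ((n : ℚ) + 1) ≠ 0 := by positivity
    rw [show ((n + 1 : ℕ) : ℚ) = (n : ℚ) + 1 by push_cast; ring, mul_inv_cancel₀ hn1, one_mul]

/-- **Formal fundamental theorem of calculus in one variable under the cube integral.**  For a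
monomial weight `a t^d` not involving the variable `t_v` and any polynomial `H`,
`∫ a t^d · ∂_{t_v} H dt = ∫ a t^d · (H|_{t_v = 1} - H|_{t_v = 0}) dt` (integrate `t_v` over `[0,1]`
first). [folklore] -/
theorem cubeIntegral_monomial_mul_pderiv {v : ι} {d : ι →₀ ℕ} (hd : d v = 0) (a : R)
    (H : MvPolynomial ι R) :
    cubeIntegral ι R (monomial d a * pderiv v H) =
      cubeIntegral ι R (monomial d a * (substAt v 1 H - substAt v 0 H)) := by
  induction H using MvPolynomial.induction_on' with
  | monomial e b =>
    rw [pderiv_monomial, substAt_monomial, substAt_monomial, one_pow, mul_one, ← map_sub,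
      monomial_mul, monomial_mul, cubeIntegral_monomial, cubeIntegral_monomial]
    have h := congrArg (algebraMap ℚ R) (cubeWeight_ftc_aux hd e)
    rw [map_mul, map_mul, map_natCast, map_sub, map_one, map_pow, map_zero] at h
    calc a * (b * (e v : R)) * algebraMap ℚ R (cubeWeight (d + (e - Finsupp.single v 1)))
        = a * b * ((e v : R) * algebraMap ℚ R (cubeWeight (d + (e - Finsupp.single v 1)))) := by ring
      _ = a * b * ((1 - (0 : R) ^ e v) * algebraMap ℚ R (cubeWeight (d + e.erase v))) := by rw [h]
      _ = a * (b - b * (0 : R) ^ e v) * algebraMap ℚ R (cubeWeight (d + e.erase v)) := by ring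
  | add p q hp hq => rw [map_add, map_add, map_add, mul_add, map_add, hp, hq, ← map_add, ← mul_add]; congr 2; abel

end Cube

/-! ### The chain rule -/

/-- **Chain rule for derivations along an algebra map out of a polynomial ring**: for
`φ : MvPolynomial ι R →ₐ[R] A` (`A` commutative) and an `R`-derivation `D` of `A`,
`D (φ F) = Σᵢ φ (∂F/∂tᵢ) · D (φ tᵢ)` (finitely many variables). [folklore] -/
theorem derivation_algHom_apply [Fintype ι] {A : Type*} [CommRing A] [Algebra R A]
    (φ : MvPolynomial ι R →ₐ[R] A) (D : Derivation R A A) (F : MvPolynomial ι R) :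
    D (φ F) = ∑ i, φ (pderiv i F) * D (φ (X i)) := by
  classical
  induction F using MvPolynomial.induction_on with
  | C a => simp
  | add p q hp hq => simp only [map_add, hp, hq, add_mul, Finset.sum_add_distrib]
  | mul_X p i hp =>
    have key : ∀ j, φ (pderiv j (p * X i)) * D (φ (X j)) =
        φ (X i) * φ (pderiv j p) * D (φ (X j)) + (if i = j then φ p * D (φ (X j)) else 0) := by
      intro j
      rw [Derivation.leibniz, pderiv_X, Pi.single_apply, smul_eq_mul, smul_eq_mul, map_add, map_mul,
        map_mul]
      split_ifs with h
      · rw [map_one]; ring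
      · rw [map_zero]; ring
    rw [Finset.sum_congr rfl (fun j _ => key j), Finset.sum_add_distrib, Finset.sum_ite_eq,
      if_pos (Finset.mem_univ i), map_mul, Derivation.leibniz, smul_eq_mul, smul_eq_mul, hp,
      Finset.mul_sum]
    have hs : ∑ x, φ (X i) * (φ (pderiv x p) * D (φ (X x))) =
        ∑ x, φ (X i) * φ (pderiv x p) * D (φ (X x)) :=
      Finset.sum_congr rfl fun _ _ => by ring
    rw [hs, add_comm]

end Literature.RingTheory.MvPolynomial
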